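import Summits.ResolutionOfSingularities.ResolutionOfSingularities.Theorems.EquisingularLiftEquisingularLiftNatResidueHypDefs
import Summits.ResolutionOfSingularities.ResolutionOfSingularities.Theorems.EquisingularLiftEquisingularLiftNatResidualCut
import Summits.ResolutionOfSingularities.ResolutionOfSingularities.Theorems.EquisingularLiftEquisingularLiftNatEmbeddedZeroSteps
import Summits.ResolutionOfSingularities.ResolutionOfSingularities.Theorems.EquisingularLiftEquisingularLiftBlowupModelFirstOrderPoints
import Summits.ResolutionOfSingularities.ResolutionOfSingularities.Theorems.EquisingularLiftEquisingularLiftNatLinearCentreSupport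
import Literature.AlgebraicGeometry.Resolution.BlowupSequences
import Literature.AlgebraicGeometry.FundamentalGroup.ProjectiveSpace
import HarnessLib

/-!
# [OURS] THE BRIDGE TO THE LEAD'S HYPOTHESIS #7: «every blow-up of `H` along the reduced point `x` is regular» ⟹ `IsoHypPoint k n H ι`
# (cruxes `Theses.EquisingularLift.EquisingularLiftNat` / `…NatThree`, stmt-ResolutionOfSingularities-20038 / -20148)

[OURS · leafhand-res-equisingularlift-10 g0, 2026-08-31; cell `pub/decomp-res`] AI-produced, weaker than expert review; NOT a statement of any
manuscript; nothing here proves resolution of singularities in positive characteristic.  DEF-FREE helper; no `sorry`; standard axioms;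
ZERO named hypotheses.

The registered residual stubs `stub_elnat_three_isolated_nonNDLeaves9` of the skeletons v61 / v59 (`df9c8b28…` / `9ca743c0…`) carry the
hypothesis `¬ IsoHypPoint k n H ι` (…NatResidueHypDefs, blob #7: «the downstairs point resolution lifts», consumed by T-ISO-0
✓ `target_elnat_of_pointResolution`).  `IsoHypPoint` is BY `Iff.rfl` the predicate `PointResolvable k n H ι` (…NatResidualCut, p508745): the
integral `H ⊆ ℙⁿ_k` is resolved DOWNSTAIRS by a finite chain of blow-ups of the successive ambients at non-regular closed points of the successive
reduced strict transforms.  Hence every hypersurface class handled by the one-generation hands 7–9 through seat res-D-pv-013's one-step engine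
(ordinary multiple points, `A₂` points, first-order points, …) is ALREADY EXCLUDED from the registered isolated residual — PROVIDED the downstairs
chain is exhibited.  This file exhibits it for ONE point, from the abstract hypothesis the hands actually prove:

* `isoHypPoint_iff_pointResolvable` — the dictionary (`Iff.rfl`);
* `isoHypPoint_of_isRegular` — a regular `H` is point-resolvable with ZERO steps;
* ★★ `isoHypPoint_of_forall_isRegular_blowup_point` — **ABSTRACT, POSITION-FREE**: `H` integral, `ι : H ↪ ℙⁿ_k` a closed immersion, `x₀ ∈ H` a
  NON-REGULAR point with `ι x₀` closed and `ι(H) ≠ {ι x₀}`; if EVERY blow-up of `H` along `𝔪_{ι x₀}·𝒪_H = (vanishingIdeal {ι x₀}).comap ι` is a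
  regular scheme, then `IsoHypPoint k n H ι` — ONE chain step: the blow-up `Bl_{ι x₀} ℙⁿ_k` (tree `blowup`), whose reduced strict transform of `ι(H)`
  is a blow-up of `H` along that point (✓ `isRegular_reducedStrictTransform_of_forall_isRegular_blowup`, res-type-051, Stacks 080E);
* `subsingleton_projectiveSpace_zero` — `ℙ⁰_k` has one point (✓ `isIso_projectiveSpace_zero_hom`), so the support of a coordinate VERTEX ideal
  `Λ_c = ker Proj(f^{(c)})` is the singleton `{P_c}` and `Λ_c` IS the reduced point (`vanishingIdeal`);
* ★★ `isoHypPoint_of_oneStepVertex` — **EXPLICIT**: `F` a prime form over `K = K̄` whose only singular point is the vertex `P_c`, a ONE-STEP point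
  (seat res-D-pv-013's T-ONESTEP datum: `F(x_c := 1) = Φ + Ψ`, explicit strict transforms `G_l` with a Jacobian certificate; chart singular only at
  the origin; the other vertex charts regular) ⟹ `IsoHypPoint K (m+2) V₊(F) ι` (✓ `OneStep.isRegular_of_isBlowup_comap_prod` with `S = [c]`);
* ★ `isoHypPoint_of_firstOrderVertex` — the same from hand 9's intrinsic FIRST-ORDER criterion «`Φ_μ`, `∇Φ_μ`, `Ψ_{μ+1}` have no common non-zero
  zero» (✓ `FirstOrderPoint.exists_strictTransform`): ordinary multiple points, `A₂`, characteristic-2 nodes, …;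
* `elNatAt_of_isoHypPoint` — and back to the route currency: `IsoHypPoint ⟹ ELNatAt` for hypersurfaces (lead's ✓ `horizAt_of_pointResolvable` ∘
  ✓ `elNatAt_of_horizAt`), so nothing of hands 7–9's EL♮ conclusions is lost by going through hypothesis #7.

CENSUS CORRECTION (for the planner): the «towers of point blow-ups» infrastructure named as missing in the lh8/lh9 repair censuses IS in the tree on
the `O`-side — T-ISO-0 (sections, p505885) and T-ISO-2 ✓ `elNatAt_of_pointResolvable_embDim` (ramified multisections, ANY closed points); what a
point-resolvable class needs is ONLY its downstairs chain.  The multi-point / arbitrary-position version of this file's bridge needs one more brick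
(«regularity of the blow-up at a point is local on the base», to move the one-step datum across the earlier steps of the chain) — not done here.

Honest label: closes no registered stub; `stub_elnat_three_isolated_nonNDLeaves9` is untouched (its hypothesis list already excludes these `H`).

References: [StacksProject, Tags 080E, 0804, 01J5]; [Hartshorne1977, I Thm. 5.1, II Ex. 7.12]; [Liu2002, §8.1] — through the cited tree files.
-/

set_option linter.dupNamespace false

noncomputable section

open CategoryTheory CategoryTheory.Limits AlgebraicGeometry TopologicalSpace
open Literature.AlgebraicGeometry.Resolution Literature.AlgebraicGeometry.Motives
open AlgebraicGeometry.Scheme.IdealSheafData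
open Summit.ResolutionOfSingularities.ResolutionOfSingularities.Theorems.EquisingularLiftNatResidualCut

namespace Summit.ResolutionOfSingularities.ResolutionOfSingularities.Cruxes.EquisingularLiftNat.Sections

/-- **Dictionary**: the lead's hypothesis blob #7 `IsoHypPoint k n H ι` IS `PointResolvable k n H ι` (T-ISO-0's downstairs clause at
`(ℙⁿ_k, range ι)`), by `Iff.rfl`. [OURS] [folklore] -/
theorem isoHypPoint_iff_pointResolvable (k : Type) [Field k] [IsAlgClosed k] (n : ℕ) (H : Scheme.{0})
    (ι : H ⟶ (projectiveSpace n k).left) : IsoHypPoint k n H ι ↔ PointResolvable k n H ι :=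
  Iff.rfl

/-- **A regular `H` is point-resolvable with zero steps**: the witness is `(ℙⁿ_k, 𝟙, range ι)`, whose reduced closure is `≅ H`
(`IsClosedImmersion.lift`). [OURS] [cite: StacksProject, Tag 01J5] -/
theorem isoHypPoint_of_isRegular (k : Type) [Field k] [IsAlgClosed k] (n : ℕ) (H : Scheme.{0})
    (ι : H ⟶ (projectiveSpace n k).left) [IsClosedImmersion ι] [IsReduced H] (hreg : Scheme.IsRegular H) :
    IsoHypPoint k n H ι := by
  refine ⟨(projectiveSpace n k).left, 𝟙 _, Set.range ι, fun Q h0 _ => h0, ?_⟩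
  -- `H ≅ V(closure ι(H))_red`
  let TD : Closeds (projectiveSpace n k).left := ⟨closure (Set.range ι), isClosed_closure⟩
  have hDker : vanishingIdeal TD = ι.ker := by
    rw [← Scheme.IdealSheafData.map_bot, ← Scheme.nilradical_eq_bot, ← Scheme.IdealSheafData.vanishingIdeal_top,
      Scheme.IdealSheafData.map_vanishingIdeal]
    congr 1
    ext1
    change closure (Set.range ι) = closure (ι '' Set.univ)
    rw [Set.image_univ]
  have hkerD : (vanishingIdeal TD).subschemeι.ker = ι.ker := by
    rw [Scheme.IdealSheafData.ker_subschemeι, hDker]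
  let eD : H ⟶ (vanishingIdeal TD).subscheme := IsClosedImmersion.lift _ ι hkerD.le
  haveI : IsIso eD := IsClosedImmersion.isIso_lift _ ι hkerD
  exact Scheme.IsRegular.of_iso eD hreg

/-- ★★ **ONE POINT BLOW-UP DOWNSTAIRS, ABSTRACT AND POSITION-FREE.**  `k` algebraically closed, `H` integral, `ι : H ↪ ℙⁿ_k` a closed
immersion, `x₀ ∈ H` a NON-REGULAR point with `ι x₀` closed and `ι(H) ⊄ {ι x₀}`.  If every blow-up of `H` along the reduced point
`(vanishingIdeal {ι x₀}).comap ι = 𝔪_{x₀}·𝒪_H` is a regular scheme, then `IsoHypPoint k n H ι`: the downstairs chain is the single blow-up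
`Bl_{ι x₀} ℙⁿ_k → ℙⁿ_k` (tree `blowup`) at the point `x₀` of `V(closure ι(H))_red ≅ H`, and its reduced strict transform
`V(closure υ⁻¹(ι(H) ∖ {ι x₀}))_red` is regular by res-type-051's ✓ `isRegular_reducedStrictTransform_of_forall_isRegular_blowup`
(it is a blow-up of `H` along `𝔪_{x₀}·𝒪_H`, Stacks 080E). [OURS] [cite: StacksProject, Tag 080E] -/
theorem isoHypPoint_of_forall_isRegular_blowup_point (k : Type) [Field k] [IsAlgClosed k] (n : ℕ) (H : Scheme.{0})
    (ι : H ⟶ (projectiveSpace n k).left) [IsClosedImmersion ι] [IsIntegral H]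
    (x₀ : H) (hx₀ : IsClosed ({ι x₀} : Set (projectiveSpace n k).left))
    (hsing : ¬ IsRegularLocalRing (H.presheaf.stalk x₀))
    (hgen : ¬ (Set.range ι ⊆ {ι x₀}))
    (hreg : ∀ (Z : Scheme.{0}) (ρ : Z ⟶ H), IsBlowup ρ ((vanishingIdeal ⟨{ι x₀}, hx₀⟩).comap ι) → Scheme.IsRegular Z) :
    IsoHypPoint k n H ι := by
  -- the centre and a blow-up along it
  obtain ⟨Λ, hΛ⟩ : ∃ Λ : ((projectiveSpace n k).left).IdealSheafData, Λ = vanishingIdeal ⟨{ι x₀}, hx₀⟩ := ⟨_, rfl⟩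
  rw [← hΛ] at hreg
  have hΛsupp : (Λ.support : Set (projectiveSpace n k).left) = {ι x₀} := by
    rw [hΛ, Scheme.IdealSheafData.coe_support_vanishingIdeal]; rfl
  have hυ : IsBlowup (blowup.π Λ) Λ := blowup.isBlowup Λ
  -- `H ≅ V(closure ι(H))_red`, compatibly with the embeddings
  let TD : Closeds (projectiveSpace n k).left := ⟨closure (Set.range ι), isClosed_closure⟩
  have hDker : vanishingIdeal TD = ι.ker := by
    rw [← Scheme.IdealSheafData.map_bot, ← Scheme.nilradical_eq_bot, ← Scheme.IdealSheafData.vanishingIdeal_top,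
      Scheme.IdealSheafData.map_vanishingIdeal]
    congr 1
    ext1
    change closure (Set.range ι) = closure (ι '' Set.univ)
    rw [Set.image_univ]
  have hkerD : (vanishingIdeal TD).subschemeι.ker = ι.ker := by
    rw [Scheme.IdealSheafData.ker_subschemeι, hDker]
  let eD : H ⟶ (vanishingIdeal TD).subscheme := IsClosedImmersion.lift _ ι hkerD.le
  have heD : eD ≫ (vanishingIdeal TD).subschemeι = ι := IsClosedImmersion.lift_fac _ ι hkerD.le
  haveI : IsIso eD := IsClosedImmersion.isIso_lift _ ι hkerD
  -- the point of `V(closure ι(H))_red` over `ι x₀`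
  obtain ⟨x, hxdef⟩ : ∃ x : ↥(vanishingIdeal TD).subscheme, x = eD x₀ := ⟨_, rfl⟩
  have hxι : (vanishingIdeal TD).subschemeι x = ι x₀ := by
    rw [hxdef, ← Scheme.Hom.comp_apply, heD]
  have hx : IsClosed ({((vanishingIdeal TD).subschemeι x : (projectiveSpace n k).left)} : Set (projectiveSpace n k).left) := by
    rw [hxι]; exact hx₀
  -- non-regularity at `x`
  have hxsing : ¬ IsRegularLocalRing ((vanishingIdeal TD).subscheme.presheaf.stalk x) := by
    intro h
    apply hsing
    rw [hxdef] at h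
    haveI := h
    exact IsRegularLocalRing.of_ringEquiv (asIso (eD.stalkMap x₀)).commRingCatIsoToRingEquiv
  -- the centres agree
  have hC : (⟨{((vanishingIdeal TD).subschemeι x : (projectiveSpace n k).left)}, hx⟩ : Closeds (projectiveSpace n k).left) =
      ⟨{ι x₀}, hx₀⟩ := Closeds.ext (by
    change ({((vanishingIdeal TD).subschemeι x : (projectiveSpace n k).left)} : Set (projectiveSpace n k).left) = {ι x₀}
    rw [hxι])
  have hυ' : IsBlowup (blowup.π Λ) (vanishingIdeal (⟨{((vanishingIdeal TD).subschemeι x : (projectiveSpace n k).left)}, hx⟩ :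
      Closeds (projectiveSpace n k).left)) := by
    rw [hC, ← hΛ]; exact hυ
  refine ⟨blowup Λ, blowup.π Λ ≫ 𝟙 _, closure ((blowup.π Λ) ⁻¹' (Set.range ι \ {((vanishingIdeal TD).subschemeι x : (projectiveSpace n k).left)})),
    fun Q h0 hstep => ?_, ?_⟩
  · exact hstep _ (blowup Λ) (𝟙 _) (Set.range ι) x (blowup.π Λ) hx h0 hxsing hυ'
  · -- regularity of the reduced strict transform
    haveI : IsLocallyNoetherian (projectiveSpace n k).left :=
      AlgebraicGeometry.LocallyOfFiniteType.isLocallyNoetherian (projectiveSpace n k).hom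
    have hgen' : ¬ (Set.range ι ⊆ (Λ.support : Set (projectiveSpace n k).left)) := by rwa [hΛsupp]
    have key := isRegular_reducedStrictTransform_of_forall_isRegular_blowup ι Λ hgen' hreg (blowup Λ) (blowup.π Λ) hυ
    have hcl : (⟨closure (closure ((blowup.π Λ) ⁻¹' (Set.range ι \ {((vanishingIdeal TD).subschemeι x : (projectiveSpace n k).left)}))),
        isClosed_closure⟩ : Closeds (blowup Λ)) =
        ⟨closure ((blowup.π Λ) ⁻¹' (Set.range ι \ (Λ.support : Set (projectiveSpace n k).left))), isClosed_closure⟩ := Closeds.ext (by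
      change closure (closure _) = closure _
      rw [closure_closure, hΛsupp, hxι])
    rw [hcl]
    exact key


/-! ## The explicit corollary: one one-step singular point at a coordinate vertex -/

/-- **`ℙ⁰_k` has at most one point** (`ℙ⁰_k → Spec k` is an isomorphism, ✓ `isIso_projectiveSpace_zero_hom`; `Spec` of a field is one point).
[folklore] [cite: Hartshorne1977, II Ex. 2.14] -/
theorem subsingleton_projectiveSpace_zero (k : Type) [Field k] : Subsingleton ↥(projectiveSpace 0 k).left := by
  haveI := Literature.AlgebraicGeometry.FundamentalGroup.ProjectiveSpace.isIso_projectiveSpace_zero_hom k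
  refine ⟨fun a b => ?_⟩
  have hinj : Function.Injective (projectiveSpace 0 k).hom.base :=
    (Scheme.homeoOfIso (asIso (projectiveSpace 0 k).hom)).injective
  apply hinj
  exact Subsingleton.elim _ _

section Vertex

open MvPolynomial HomogeneousLocalization
open Literature.AlgebraicGeometry.Motives.SmoothHypersurface Literature.AlgebraicGeometry.Motives.ProjectiveSpace
open Summit.ResolutionOfSingularities.ResolutionOfSingularities.Cruxes.EquisingularLift.StrataSplit

/-- ★★ **A HYPERSURFACE WHOSE ONLY SINGULAR POINT IS A ONE-STEP VERTEX SATISFIES THE LEAD'S HYPOTHESIS #7 `IsoHypPoint`** — every dimension,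
every characteristic.  `K` algebraically closed; `F ∈ K[x₀,…,x_{m+2}]` a prime form; `c` a coordinate such that the vertex chart is
`F(x_c := 1) = Φ + Ψ` (`Φ ≠ 0` a form of degree `μ ≥ 1`, `Ψ ∈ (y)^{μ+1}`) with explicit strict transforms `G_l` (`(Φ+Ψ)(T_l, T_lT_j) = T_l^μ·G_l`)
passing the Jacobian criterion at the primes containing `T_l` (seat res-D-pv-013's ONE-STEP datum), the chart singular at most at the origin
(prime-ideal Jacobian hypothesis), every other vertex chart `ChartRing F c'` regular; and `V₊(F)` NON-REGULAR at its point over the vertex `P_c` (all `x_a`, `a ≠ c`,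
vanish there).  Then `IsoHypPoint K (m+2) V₊(F) ι`.  Proof: the vertex ideal `Λ_c = ker Proj(f^{(c)})` has support
`{ι x₀}` (`ℙ⁰` is a point) and is the reduced point; every blow-up of `V₊(F)` along `Λ_c·𝒪` is regular by ✓ `OneStep.isRegular_of_isBlowup_comap_prod`
(`S = [c]`); `ι(V₊(F)) ≠ {P_c}` by ✓ `MultiOrd.exists_X_ne_not_mem_span`; conclude by `isoHypPoint_of_forall_isRegular_blowup_point`.
[OURS] [cite: Hartshorne1977, I Thm. 5.1] [cite: StacksProject, Tag 080A] -/
theorem isoHypPoint_of_oneStepVertex (K : Type) [Field K] [IsAlgClosed K] {m : ℕ}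
    (F : MvPolynomial (Fin (m + 2 + 1)) K) {d : ℕ} (hF : F.IsHomogeneous d) (hFp : Prime F) (c : Fin (m + 2 + 1))
    (hone : ∃ (μ : ℕ) (Φ Ψ : MvPolynomial (Fin (m + 2)) K), 1 ≤ μ ∧ Φ.IsHomogeneous μ ∧ Φ ≠ 0 ∧
      Ψ ∈ Ideal.span (Set.range (X : Fin (m + 2) → MvPolynomial (Fin (m + 2)) K)) ^ (μ + 1) ∧ ProjectiveSpace.dehomogenize K c F = Φ + Ψ ∧
      ∀ l : Fin (m + 2), ∃ G : MvPolynomial (Fin (m + 2)) K,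
        aeval (fun j => X l * Function.update (X : Fin (m + 2) → MvPolynomial (Fin (m + 2)) K) l 1 j) (Φ + Ψ) = X l ^ μ * G ∧
        ∀ P : Ideal (MvPolynomial (Fin (m + 2)) K), P.IsPrime → (X l : MvPolynomial (Fin (m + 2)) K) ∈ P → G ∈ P → ∃ j, pderiv j G ∉ P)
    (hsing : ∀ P : Ideal (MvPolynomial (Fin (m + 2)) K), P.IsPrime → ProjectiveSpace.dehomogenize K c F ∈ P →
      (∀ j, pderiv j (ProjectiveSpace.dehomogenize K c F) ∈ P) → ∀ j, (X j : MvPolynomial (Fin (m + 2)) K) ∈ P)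
    (hsingpt : letI := MvPolynomial.gradedAlgebra (σ := Fin (m + 2 + 1)) (R := K)
      ∀ x : ↥(hypersurface F).left, (∀ a : Fin (m + 2 + 1), a ≠ c →
        (X a : MvPolynomial (Fin (m + 2 + 1)) K) ∈ ((hypersurfaceι F).left x).asHomogeneousIdeal) →
        ¬ IsRegularLocalRing ((hypersurface F).left.presheaf.stalk x))
    (hoff : letI := MvPolynomial.gradedAlgebra (σ := Fin (m + 2 + 1)) (R := K)
      ∀ c', c' ≠ c → IsRegularRing (ChartRing F c' hF)) :
    letI := MvPolynomial.gradedAlgebra (σ := Fin (m + 2 + 1)) (R := K)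
    IsoHypPoint K (m + 2) (hypersurface F).left (hypersurfaceι F).left := by
  letI := MvPolynomial.gradedAlgebra (σ := Fin (m + 2 + 1)) (R := K)
  letI := MvPolynomial.gradedAlgebra (σ := Fin (0 + 1)) (R := K)
  classical
  haveI := HypersurfaceSpecimen.isIntegral_hypersurface_of_prime K F hF hFp
  have he : ∀ c' : Fin (m + 2 + 1), Function.Injective (fun _ : Fin 1 => c') := fun c' => Function.injective_of_subsingleton _
  have hexk : ∀ c' : Fin (m + 2 + 1), ∃ (g : homogeneousSubmodule (Fin (m + 2 + 1)) K →+*ᵍ homogeneousSubmodule (Fin (0 + 1)) K)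
      (_ : HomogeneousIdeal.irrelevant (homogeneousSubmodule (Fin (0 + 1)) K) ≤
        (HomogeneousIdeal.irrelevant (homogeneousSubmodule (Fin (m + 2 + 1)) K)).map g),
      (∀ a : K, g (C a) = C a) ∧ (∀ j : Fin 1, g (X ((fun _ : Fin 1 => c') j)) = X j) ∧
        (∀ i : Fin (m + 2 + 1), i ∉ Set.range (fun _ : Fin 1 => c') → g (X i) = 0) := fun c' =>
    LinearCentre.exists_kill (R := K) (fun _ : Fin 1 => c') (he c')
  choose fk hfk' hfkC hfke hfk0 using hexk
  have hfke' : ∀ c' (j : Fin 1), fk c' (X c') = X j := fun c' j => hfke c' j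
  have hfk0' : ∀ c' (i : Fin (m + 2 + 1)), i ≠ c' → fk c' (X i) = 0 := fun c' i hi => hfk0 c' i (fun ⟨_, hj⟩ => hi hj.symm)
  -- the vertex `P_c`: a point of `supp Λ_c`, `Λ_c = ker Proj(f^{(c)})`, which lies on `V₊(F)`
  have hne : ((Proj.map (fk c) (hfk' c)).ker.support : Set (Proj (homogeneousSubmodule (Fin (m + 2 + 1)) K))).Nonempty := by
    rw [LinearCentre.support_ker_eq_range (fun _ : Fin 1 => c) (fk c) (hfk' c) (hfkC c) (hfke c)]
    exact ⟨_, ⟨Literature.AlgebraicGeometry.Motives.coordSubspacePoint (k := K) (N := 0) ∅ (by simp), rfl⟩⟩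
  obtain ⟨v, hv⟩ := hne
  have hvX : ∀ a : Fin (m + 2 + 1), a ≠ c → (X a : MvPolynomial (Fin (m + 2 + 1)) K) ∈ v.asHomogeneousIdeal := fun a ha =>
    CoordPoints.X_mem_of_mem_support fk hfk' hfkC hfke' hfk0' hv ha
  have hvrange : v ∈ Set.range (hypersurfaceι F).left := by
    obtain ⟨μ, Φ, Ψ, hμ, hΦ, -, hΨ, hdeh, -⟩ := hone
    refine (Set.ext_iff.mp (range_hypersurfaceι F) v).mpr ((ProjectiveSpectrum.mem_zeroLocus _ _ _).mpr (Set.singleton_subset_iff.mpr ?_))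
    change F ∈ v.asHomogeneousIdeal
    exact (Ideal.span_le.mpr (Set.range_subset_iff.mpr fun j => hvX _ (Fin.succAbove_ne c j)))
      (OrdPointAt.mem_span_X_succAbove K F c hF Φ Ψ hΦ hμ hΨ hdeh)
  obtain ⟨x₀, hx₀v⟩ := hvrange
  have hx₀ : ∀ a : Fin (m + 2 + 1), a ≠ c → (X a : MvPolynomial (Fin (m + 2 + 1)) K) ∈ ((hypersurfaceι F).left x₀).asHomogeneousIdeal := by
    rw [hx₀v]; exact hvX
  have hx₀sing : ¬ IsRegularLocalRing ((hypersurface F).left.presheaf.stalk x₀) := hsingpt x₀ hx₀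
  have hmem : (hypersurfaceι F).left x₀ ∈ ((Proj.map (fk c) (hfk' c)).ker.support : Set (Proj (homogeneousSubmodule (Fin (m + 2 + 1)) K))) := by
    rw [hx₀v]; exact hv
  have hsupp : ((Proj.map (fk c) (hfk' c)).ker.support : Set (Proj (homogeneousSubmodule (Fin (m + 2 + 1)) K))) =
      {(hypersurfaceι F).left x₀} := by
    refine Set.Subsingleton.eq_singleton_of_mem ?_ hmem
    rw [LinearCentre.support_ker_eq_range (fun _ : Fin 1 => c) (fk c) (hfk' c) (hfkC c) (hfke c)]
    haveI : Subsingleton ↥(Proj (homogeneousSubmodule (Fin (0 + 1)) K)) := subsingleton_projectiveSpace_zero K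
    rintro _ ⟨i, rfl⟩ _ ⟨j, rfl⟩
    rw [Subsingleton.elim i j]
  have hx₀cl : IsClosed ({(hypersurfaceι F).left x₀} : Set (Proj (homogeneousSubmodule (Fin (m + 2 + 1)) K))) := by
    rw [← hsupp]; exact (Proj.map (fk c) (hfk' c)).ker.support.isClosed
  -- the vertex ideal IS the reduced point `ι x₀`
  have hΛ : vanishingIdeal ⟨{(hypersurfaceι F).left x₀}, hx₀cl⟩ = (Proj.map (fk c) (hfk' c)).ker := by
    haveI : IsClosedImmersion (Proj.map (fk c) (hfk' c)) :=
      LinearCentre.isClosedImmersion_projMap_kill (fun _ : Fin 1 => c) (fk c) (hfk' c) (hfkC c) (hfke c)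
    haveI : IsReduced (Proj (homogeneousSubmodule (Fin (0 + 1)) K)) := inferInstanceAs (IsReduced (projectiveSpace 0 K).left)
    rw [← Scheme.IdealSheafData.map_bot, ← Scheme.nilradical_eq_bot, ← Scheme.IdealSheafData.vanishingIdeal_top,
      Scheme.IdealSheafData.map_vanishingIdeal]
    congr 1
    ext1
    change ({(hypersurfaceι F).left x₀} : Set (Proj (homogeneousSubmodule (Fin (m + 2 + 1)) K))) =
      closure ((Proj.map (fk c) (hfk' c)) '' ((⊤ : Closeds (Proj (homogeneousSubmodule (Fin (0 + 1)) K))) : Set _))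
    rw [Closeds.coe_top, Set.image_univ, ← LinearCentre.support_ker_eq_range (fun _ : Fin 1 => c) (fk c) (hfk' c) (hfkC c) (hfke c),
      hsupp, hx₀cl.closure_eq]
  -- every blow-up of `H` along the reduced point is regular (T-ONESTEP, downstairs, one marked vertex)
  have hreg : ∀ (Z : Scheme.{0}) (ρ : Z ⟶ (hypersurface F).left),
      IsBlowup ρ ((vanishingIdeal ⟨{(hypersurfaceι F).left x₀}, hx₀cl⟩).comap (hypersurfaceι F).left) → Scheme.IsRegular Z := by
    intro Z ρ hρ
    rw [hΛ] at hρ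
    have hprod : (([c].map fun c' => (Proj.map (fk c') (hfk' c')).ker).prod) = (Proj.map (fk c) (hfk' c)).ker := by
      rw [List.map_singleton, List.prod_singleton]
    rw [← hprod] at hρ
    refine OneStep.isRegular_of_isBlowup_comap_prod K F hF hFp [c] (List.nodup_singleton c) (fun c' hc' => ?_) (fun c' hc' => ?_)
      (fun c' hc' => hoff c' (fun h => hc' (by rw [h]; exact List.mem_singleton_self c))) fk hfk' hfkC hfke' hfk0' Z ρ hρ
    · rw [List.mem_singleton] at hc'
      subst hc'
      exact hone
    · rw [List.mem_singleton] at hc'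
      subst hc'
      exact hsing
  -- `ι(H) ⊄ {ι x₀}`: the generic point of `H` is no vertex
  have hgen : ¬ (Set.range (hypersurfaceι F).left ⊆ {(hypersurfaceι F).left x₀}) := by
    intro h
    have hmemP : (pointOfPrime F hF hFp : Proj (homogeneousSubmodule (Fin (m + 2 + 1)) K)) ∈ Set.range (hypersurfaceι F).left := by
      refine (Set.ext_iff.mp (range_hypersurfaceι F) _).mpr ((ProjectiveSpectrum.mem_zeroLocus _ _ _).mpr (Set.singleton_subset_iff.mpr ?_))
      exact Ideal.subset_span rfl
    have hyc : (pointOfPrime F hF hFp : Proj (homogeneousSubmodule (Fin (m + 2 + 1)) K)) ∈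
        ((Proj.map (fk c) (hfk' c)).ker.support : Set (Proj (homogeneousSubmodule (Fin (m + 2 + 1)) K))) := by
      rw [hsupp]; exact h hmemP
    obtain ⟨a, hac, ha⟩ := MultiOrd.exists_X_ne_not_mem_span K F hFp c
    exact ha (CoordPoints.X_mem_of_mem_support fk hfk' hfkC hfke' hfk0' hyc hac)
  exact isoHypPoint_of_forall_isRegular_blowup_point K (m + 2) (hypersurface F).left (hypersurfaceι F).left x₀ hx₀cl hx₀sing hgen hreg

/-- ★ **FIRST-ORDER VERTEX ⟹ `IsoHypPoint`.**  As `isoHypPoint_of_oneStepVertex`, with the one-step datum replaced by hand 9's intrinsic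
FIRST-ORDER criterion: `F(x_c := 1) = Φ + (Ψ₁ + Ψ')`, `Φ ≠ 0` a form of degree `μ ≥ 1`, `Ψ₁` a form of degree `μ + 1`, `Ψ' ∈ (y)^{μ+2}`, and every
prime containing `Φ`, all `∂Φ/∂y_i` and `Ψ₁` contains all `y_i` (✓ `FirstOrderPoint.exists_strictTransform` supplies the `G_l`).  Covers ordinary
multiple points, `A₂` points and characteristic-2 nodes at a vertex. [OURS] [cite: Hartshorne1977, I Thm. 5.1, I Ex. 5.8] -/
theorem isoHypPoint_of_firstOrderVertex (K : Type) [Field K] [IsAlgClosed K] {m : ℕ}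
    (F : MvPolynomial (Fin (m + 2 + 1)) K) {d : ℕ} (hF : F.IsHomogeneous d) (hFp : Prime F) (c : Fin (m + 2 + 1))
    (hfo : ∃ (μ : ℕ) (Φ Ψ₁ Ψ' : MvPolynomial (Fin (m + 2)) K), 1 ≤ μ ∧ Φ.IsHomogeneous μ ∧ Φ ≠ 0 ∧ Ψ₁.IsHomogeneous (μ + 1) ∧
      Ψ' ∈ Ideal.span (Set.range (X : Fin (m + 2) → MvPolynomial (Fin (m + 2)) K)) ^ (μ + 2) ∧
      ProjectiveSpace.dehomogenize K c F = Φ + (Ψ₁ + Ψ') ∧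
      ∀ P : Ideal (MvPolynomial (Fin (m + 2)) K), P.IsPrime → Φ ∈ P → (∀ i, pderiv i Φ ∈ P) → Ψ₁ ∈ P →
        ∀ i, (X i : MvPolynomial (Fin (m + 2)) K) ∈ P)
    (hsing : ∀ P : Ideal (MvPolynomial (Fin (m + 2)) K), P.IsPrime → ProjectiveSpace.dehomogenize K c F ∈ P →
      (∀ j, pderiv j (ProjectiveSpace.dehomogenize K c F) ∈ P) → ∀ j, (X j : MvPolynomial (Fin (m + 2)) K) ∈ P)
    (hsingpt : letI := MvPolynomial.gradedAlgebra (σ := Fin (m + 2 + 1)) (R := K)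
      ∀ x : ↥(hypersurface F).left, (∀ a : Fin (m + 2 + 1), a ≠ c →
        (X a : MvPolynomial (Fin (m + 2 + 1)) K) ∈ ((hypersurfaceι F).left x).asHomogeneousIdeal) →
        ¬ IsRegularLocalRing ((hypersurface F).left.presheaf.stalk x))
    (hoff : letI := MvPolynomial.gradedAlgebra (σ := Fin (m + 2 + 1)) (R := K)
      ∀ c', c' ≠ c → IsRegularRing (ChartRing F c' hF)) :
    letI := MvPolynomial.gradedAlgebra (σ := Fin (m + 2 + 1)) (R := K)
    IsoHypPoint K (m + 2) (hypersurface F).left (hypersurfaceι F).left := by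
  letI := MvPolynomial.gradedAlgebra (σ := Fin (m + 2 + 1)) (R := K)
  refine isoHypPoint_of_oneStepVertex K F hF hFp c ?_ hsing hsingpt hoff
  obtain ⟨μ, Φ, Ψ₁, Ψ', hμ, hΦ, hΦ0, hΨ₁, hΨ', hdeh, hcrit⟩ := hfo
  exact ⟨μ, Φ, Ψ₁ + Ψ', hμ, hΦ, hΦ0, FirstOrderPoint.add_mem_pow_succ K hΨ₁ hΨ', hdeh,
    fun l => FirstOrderPoint.exists_strictTransform K Φ Ψ₁ Ψ' hΦ hΨ₁ hΨ' hcrit l⟩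

end Vertex

/-! ## Back to the route currency -/

/-- **`IsoHypPoint ⟹ ELNatAt` for the crux's binders** (`p` prime, `k = k̄` of characteristic `p`, `H ⊆ ℙⁿ_k` integral closed with locally
principal ideal): the lead's T-ISO-0 ✓ `horizAt_of_pointResolvable` (Hensel sections through the blown-up points) followed by
✓ `elNatAt_of_horizAt`.  So routing the hands' one-step classes through hypothesis #7 loses nothing of their EL♮ conclusions. [OURS] [folklore] -/
theorem elNatAt_of_isoHypPoint (p : ℕ) (hp : p.Prime) (k : Type) [Field k] [CharP k p] [IsAlgClosed k] (n : ℕ) (H : Scheme.{0})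
    (ι : H ⟶ (projectiveSpace n k).left) (hι : IsClosedImmersion ι) (hH : IsIntegral H)
    (hloc : ∀ y : (projectiveSpace n k).left, ∃ U : (projectiveSpace n k).left.affineOpens,
      y ∈ (U : (projectiveSpace n k).left.Opens) ∧ (ι.ker.ideal U).IsPrincipal)
    (h : IsoHypPoint k n H ι) :
    Summit.ResolutionOfSingularities.ResolutionOfSingularities.Theorems.EquisingularLift.ELNatAt p k n H ι :=
  elNatAt_of_horizAt p k n H ι hι hH (horizAt_of_pointResolvable p hp k n H ι hι hH hloc ((isoHypPoint_iff_pointResolvable k n H ι).mp h))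

end Summit.ResolutionOfSingularities.ResolutionOfSingularities.Cruxes.EquisingularLiftNat.Sections

end
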